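/-
Copyright (c) 2026 the pub-hodgecm-mathlib formalisation cell (harness21).  Prover seat hodgecm-mathlib-K2E5-p04 (g3), HCML Track B «K2-LIT» (build stream 29),
h413 = `stmt-HodgeConjecture-24833`, line `K2_E3_EllipticInputs`, unit U12 «Characters», socket #11 road (11-SC), letter (SC-an), END-GAME MAP v4 (line lead
K2E3-p14 (g3), `K2/STATUS.md` 2026-09-04T03:12:52Z «(M5h) PACKAGING OWNER = K2E5-p04 (g3)»; RULINGS #12 03:17:56Z, head + design countersigned): piece (M5h) FILE B —
THE (SC-an) ∃-DATUM AT `N = 3` MODULO THE ONE NAMED LETTER «HC-14-ell».  2026-09-04.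
-/
import Summits.HodgeConjecture.HodgeConjecture.Theorems.K2E3SupercuspidalTruncatedCharWeightKit     -- ★ (M5h) FILE A p857048 (this seat): shell bound at the place, shell index, token, `hW` on the model, height weight; brings ★ [M6′] A∕B∕C, ★ [M6], ★ p856355
import Literature.Algebra.Polynomial.DiscriminantSignRealRoots                                         -- ★ `discr_ne_zero_iff_separable` (Basu–Pollack–Roy Prop. 4.3)
import HarnessLib

/-!
# h413 ∕ Track B «K2-LIT», line `K2_E3_EllipticInputs`, unit U12, road (11-SC), letter (SC-an) — (M5h) FILE B: THE (SC-an) DATUM FOR A SUPERCUSPIDAL `SmoothIrrep` OF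
# `U₃(H)(L⁺_v)` AT A NON-SPLIT PLACE, MODULO HARISH-CHANDRA'S THEOREM 14 ON THE COMPACT CARTAN SUBGROUPS («HC-14-ell»)
# (Harish-Chandra 1970, Part VII §3 Theorem 16 and its proof pp. 70–73; Theorems 14, 15, 18–20)

Cell `pub/hodgecm-mathlib`, crux H413 = `stmt-HodgeConjecture-24833`, route of record `HCCMUnconditional`; chair K2-lead (g0), dealer K2E3-plan (g2), (SC-an) line lead K2E3-p14 (g3)
(RULINGS #12: «(Q1) letter bytes = cand v1 `sig_K2E3HC14EllRankOne` AS IS; (Q2) DROP the HC-D-ε binder — `hcd_model_rpow` is ★; head GO»).  THEOREMS ONLY (no `def`, no `instance`,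
no `notation`, no `sorry`; ONE named-letter HYPOTHESIS `hEll` = the residual leaf «HC-14-ell» of U12 :246, bytes of `K2/K2E3-p14/g3/sig_K2E3HC14EllRankOne.cand.v1` ∀-closed at
`K : Type`); lane `--supports stmt-HodgeConjecture-24833 --as helper`, count-neutral.

THE HEAD.  **`sigSCan_datum_of_hc14Ell (hEll) L H hH hdet v hns μ r hsc B hBinv v₁ : ∃ Ω F M, (SC-lim∖ell) ∧ (SC-dom) ∧ LocallyIntegrable M μ`** = the ∃-consequent of ★ p856355
`sigSCan_datum_of_bricks` ∕ the `hSC`-tail of ★ p856184 at `N = 3`, `G = (cmDatum L 3 H).Local v`, `v` non-split, EVERY hermitian `H` (`det H ≠ 0`), Haar `μ`, supercuspidal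
`SmoothIrrep r`, invariant `B`, `v₁`.  PROOF: `H_w` ANISOTROPIC ⇒ `G` compact (★ `compactSpace_local_of_anisotropic`), ★ [M6]'s `Ω F Bset` and the CONSTANT weight `‖θ‖_∞·μ(G)` (§1,
letter-free); `H_w` ISOTROPIC ⇒ along ★ (f2)'s `e : G ≃ₜ* U(σ_w, Φ₃)(L_w)` and the height balls ★ p856390: ★ [M6′] FILE B `explicit_limit_localisation_and_hball_reduction` (`Ω R m_θ F
Bset`, `hlim`, `hcanc`, datum, a.e. regularity, the two reductions); weight `W := W_M ∘ e`, `W_M(m) = K₀·(h(m)+1)·q^{h(m)}·T(m)⁻¹(1+|log T(m)|)` (`h = Ω_M.find`), locally integrable by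
★ FILE A (HC-D-ε ★ `hcd_model_rpow`), dominating the split shell bound (★ FILE A §1 at the datum, `τ = ⌈log_q T⁻¹⌉₊`, `λ_min ≤ 4τ + 10h` ★ (M5e-2)) and the elliptic full-orbital bound
of the LETTER `hEll` (`S := Ω_M m_θ`, `Θ := ‖θ_M‖ₑ`); ★ p856355 concludes (§2); §3 dispatches.

HONEST LABEL.  HC_CM is proved only modulo the 7 printed citations (2 remaining named inputs: hLiu418 = `stmt-HodgeConjecture-24832`, h413 = `stmt-HodgeConjecture-24833`)
until rung 0 closes; count-neutral helper: after this file the (SC-an) letter `sig_K2E3SupercuspidalTruncatedCharAnalytic` at `N = 3` is ★ MODULO EXACTLY ONE named letter,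
«HC-14-ell» (Harish-Chandra's Theorem 14 for the compact Cartan subgroups of `U(σ, Φ₃)(K)`, road E1–E5 staffed), which is NOT proved here.

## References
* [HarishChandra1970] Harish-Chandra (notes by G. van Dijk), *Harmonic Analysis on Reductive p-adic Groups*, LNM 162 (1970), Part VI §8 Theorem 14 p. 60; Part VII §1 Thm. 15
  p. 63, §2 Theorems 18–20 pp. 69–70, §3 Theorem 16 p. 67 and pp. 70–73.  * [Folland1995] G. B. Folland, *A Course in Abstract Harmonic Analysis* (1995), §2.4.
* [Rogawski1990] J. D. Rogawski, *Automorphic Representations of Unitary Groups in Three Variables*, Ann. of Math. Stud. 123 (1990), §4.9 p. 54, §7.3 p. 97, §12.2 p. 173,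
  §12.5 p. 182, §14.2 p. 232.
* [BasuPollackRoy2006] S. Basu, R. Pollack, M.-F. Roy, *Algorithms in Real Algebraic Geometry*, 2nd ed. (2006), Prop. 4.3.
-/

set_option autoImplicit false
-- the mandated namespace repeats the single-problem summit's segment (`HodgeConjecture.HodgeConjecture`)
set_option linter.dupNamespace false

noncomputable section

open MeasureTheory Measure Set Filter Topology NumberField IsDedekindDomain
open scoped NNReal ENNReal Pointwise Matrix MatrixGroups WithZero
open ValuativeRel
open Literature.NumberTheory.Automorphic Literature.NumberTheory.Automorphic.UnitaryGroup Literature.NumberTheory.Rogawski1990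
open Literature.NumberTheory.GaloisRepresentations Literature.NumberTheory.GaloisRepresentations.IsNonarchimedeanLocalField

namespace Summit.HodgeConjecture.HodgeConjecture.Cruxes.H413.K2E3SupercuspidalTruncatedCharAnalyticOfHC14Ell

variable (L : Type) [Field L] [NumberField L] [IsCMField L] (H : Matrix (Fin 3) (Fin 3) L)

/-! ## §1 The anisotropic engine: a compact group, a constant weight (no letter) -/
/-- **(SC-an) DATUM ON A COMPACT `G = (cmDatum L 3 H).Local v`** (anisotropic `H_w`): ★ [M6]'s `Ω F Bset` and the CONSTANT weight `W := ‖θ‖_∞ · μ(G)` (every ball integral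
of `‖θ(x g x⁻¹)‖` is `≤ ‖θ‖_∞ · μ(G)`), fed to ★ p856355 `sigSCan_datum_of_bricks`.  Letter-free. [cite: HarishChandra1970, Part VII §3 p. 72] [cite: Rogawski1990, §14.2 p. 232] -/
theorem sigSCan_datum_of_compactSpace (hH : (H.map (cmConjRingHom L))ᵀ = H) (hdet : H.det ≠ 0)
    (v : HeightOneSpectrum (𝓞 ↥(maximalRealSubfield L))) (hns : ∀ w : PlacesOver L v, IsCMField.complexConj L • w.1 = w.1)
    [MeasurableSpace ((UnitaryGroup.cmDatum L 3 H).Local v)] [BorelSpace ((UnitaryGroup.cmDatum L 3 H).Local v)]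
    [CompactSpace ((UnitaryGroup.cmDatum L 3 H).Local v)]
    (μ : Measure ((UnitaryGroup.cmDatum L 3 H).Local v)) [μ.IsHaarMeasure]
    (r : SmoothIrrep ((UnitaryGroup.cmDatum L 3 H).Local v)) (hsc : r.ρ.IsSupercuspidal)
    (B : r.V →ₗ⋆[ℂ] r.V →ₗ[ℂ] ℂ) (hBinv : ∀ (g : (UnitaryGroup.cmDatum L 3 H).Local v) (x y : r.V), B (r.ρ g x) (r.ρ g y) = B x y) (v₁ : r.V) :
    ∃ (Ω' : CompactExhaustion ((UnitaryGroup.cmDatum L 3 H).Local v))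
      (F' : (UnitaryGroup.cmDatum L 3 H).Local v → ℂ) (M : (UnitaryGroup.cmDatum L 3 H).Local v → ℝ),
      (∀ᵐ g ∂μ, ¬ (IsRegularElt (g.val : GL (Fin 3) (UnitaryGroup.LocalRing L v)) ∧
          IsCompact ((Subgroup.centralizer ({g} : Set ((UnitaryGroup.cmDatum L 3 H).Local v))) : Set ((UnitaryGroup.cmDatum L 3 H).Local v))) →
        Tendsto (fun n => ∫ x in Ω' n, B v₁ (r.ρ (x * g * x⁻¹) v₁) ∂μ) atTop (𝓝 (F' g))) ∧
      (∀ n : ℕ, ∀ᵐ g ∂μ, ‖∫ x in Ω' n, B v₁ (r.ρ (x * g * x⁻¹) v₁) ∂μ‖ ≤ M g) ∧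
      LocallyIntegrable M μ := by
  obtain ⟨Ω, F, Bset, hBsetc, hlim, hcanc⟩ :=
    K2E3SupercuspidalTruncatedCharLimCanc.exists_exhaustion_limit_localisation L H hH hdet v hns μ r.ρ r.isSmooth hsc B hBinv v₁ v₁
  -- the coefficient is bounded on the compact group
  have hθc : Continuous fun g : (UnitaryGroup.cmDatum L 3 H).Local v => B v₁ (r.ρ g v₁) := Representation.continuous_sesqForm_apply_apply (r.isSmooth v₁) v₁
  obtain ⟨C₀, hC₀⟩ := isCompact_univ.exists_bound_of_continuousOn hθc.continuousOn
  have hμ : μ Set.univ < ∞ := IsCompact.measure_lt_top isCompact_univ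
  -- every (set) integral of `‖θ(x g x⁻¹)‖` is at most `C₀ · μ(G)`
  have hbound : ∀ (g : (UnitaryGroup.cmDatum L 3 H).Local v) (s : Set ((UnitaryGroup.cmDatum L 3 H).Local v)),
      ∫ x in s, ‖B v₁ (r.ρ (x * g * x⁻¹) v₁)‖ ∂μ ≤ C₀ * μ.real Set.univ := fun g s => by
    have h1 : ∫ x in s, ‖B v₁ (r.ρ (x * g * x⁻¹) v₁)‖ ∂μ ≤ ∫ x, ‖B v₁ (r.ρ (x * g * x⁻¹) v₁)‖ ∂μ := by
      refine setIntegral_le_integral ?_ (Eventually.of_forall fun x => norm_nonneg _)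
      have hc : Continuous fun x : (UnitaryGroup.cmDatum L 3 H).Local v => ‖B v₁ (r.ρ (x * g * x⁻¹) v₁)‖ :=
        (hθc.comp ((continuous_id.mul continuous_const).mul continuous_inv)).norm
      exact hc.integrable_of_hasCompactSupport (HasCompactSupport.of_compactSpace _)
    have h2 : ‖∫ x in Set.univ, ‖B v₁ (r.ρ (x * g * x⁻¹) v₁)‖ ∂μ‖ ≤ C₀ * μ.real Set.univ :=
      norm_setIntegral_le_of_norm_le_const hμ fun x _ => by rw [norm_norm]; exact hC₀ _ (Set.mem_univ _)
    rw [Measure.restrict_univ] at h2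
    exact h1.trans ((le_abs_self _).trans ((Real.norm_eq_abs _).symm.le.trans h2))
  refine K2E3SupercuspidalTruncatedCharDominationOfBricks.sigSCan_datum_of_bricks L 3 H hH hdet v hns μ r hsc B hBinv v₁ Ω F hlim Bset hBsetc hcanc
    (fun _ => C₀ * μ.real Set.univ) (Eventually.of_forall fun g _ => ?_) (Eventually.of_forall fun g _ => hbound g (Bset g)) (locallyIntegrable_const _)
  have h := hbound g Set.univ
  rwa [Measure.restrict_univ] at h

/-! ## §2 The isotropic engine along a field model `e`, modulo «HC-14-ell» -/
set_option maxHeartbeats 1600000 in -- long statement (the ∀-closed letter as a binder) and a long assembly on the CM ∕ one-place carriers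
/-- **(SC-an) DATUM ALONG A FIELD MODEL `e : G ≃ₜ* U(σ_w, Φ₃)(L_w)`, MODULO «HC-14-ell»** (isotropic `H_w`; `e` from ★ (f2)): ★ [M6′] FILE B's `Ω R m_θ F Bset` with the height
balls ★ p856390; the weight `W := W_M ∘ e`, `W_M(m) = K₀·(h(m)+1)·q^{h(m)}·T(m)⁻¹(1+|log T(m)|)`, locally integrable (★ FILE A) and dominating the split shell bound (★ FILE A §1,
`τ = ⌈log_q T⁻¹⌉₊`, `λ_min ≤ 4τ + 10h`) and the elliptic full-orbital bound of the LETTER (`S := Ω_M m_θ`, `Θ := ‖θ_M‖ₑ`); ★ p856355 concludes.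
[cite: HarishChandra1970, Part VII §3 Theorem 16 p. 67, pp. 70–73; Part VI §8 Theorem 14 p. 60; Part VII §1 Thm. 15 p. 63] [cite: Rogawski1990, §4.9 p. 54, §7.3 p. 97, §12.5 p. 182] -/
theorem sigSCan_datum_of_hc14Ell_of_fieldModel
    (hEll : ∀ {K : Type} [Field K] [Valued K ℤᵐ⁰] [ValuativeRel K] [(Valued.v : Valuation K ℤᵐ⁰).Compatible] [IsNonarchimedeanLocalField K]
      [CharZero K] (σ : K →+* K) (_ : ∀ x, σ (σ x) = x) (_ : Continuous σ) (_ : ∀ x, Valued.v (σ x) = Valued.v x) (_ : ∃ x : K, σ x ≠ x)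
      {J : Matrix (Fin 3) (Fin 3) K} (_ : J = (StdForm.antidiagonal 3).over K)
      [MeasurableSpace ↥(unitaryGroupOfForm σ J)] [BorelSpace ↥(unitaryGroupOfForm σ J)] (μ : Measure ↥(unitaryGroupOfForm σ J)) [μ.IsHaarMeasure]
      {S : Set ↥(unitaryGroupOfForm σ J)} (_ : IsCompact S),
      ∃ C : ℝ≥0, ∀ Θ : ↥(unitaryGroupOfForm σ J) → ℝ≥0∞, Measurable Θ → (∀ g, Θ g ≠ 0 → g ∈ S) → ∀ M : ℝ≥0∞, (∀ g, Θ g ≤ M) →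
        ∀ γ : ↥(unitaryGroupOfForm σ J), IsRegularElt (γ : GL (Fin 3) K) →
          IsCompact ((Subgroup.centralizer ({γ} : Set ↥(unitaryGroupOfForm σ J))) : Set ↥(unitaryGroupOfForm σ J)) →
            ((NNReal.sqrt (NNReal.sqrt
                (normAbs K (((γ : GL (Fin 3) K) : Matrix (Fin 3) (Fin 3) K)).charpoly.discr *
                  (normAbs K (((γ : GL (Fin 3) K) : Matrix (Fin 3) (Fin 3) K)).det ^ 2)⁻¹)) : ℝ≥0) : ℝ≥0∞) *
              ∫⁻ x, Θ (x * γ * x⁻¹) ∂μ ≤ C * M)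
    (hH : (H.map (cmConjRingHom L))ᵀ = H) (hdet : H.det ≠ 0)
    (v : HeightOneSpectrum (𝓞 ↥(maximalRealSubfield L))) (hns : ∀ w : PlacesOver L v, IsCMField.complexConj L • w.1 = w.1)
    (w : PlacesOver L v) (hw : IsCMField.complexConj L • w.1 = w.1)
    [MeasurableSpace ((UnitaryGroup.cmDatum L 3 H).Local v)] [BorelSpace ((UnitaryGroup.cmDatum L 3 H).Local v)]
    (μ : Measure ((UnitaryGroup.cmDatum L 3 H).Local v)) [μ.IsHaarMeasure]
    (e : (UnitaryGroup.cmDatum L 3 H).Local v ≃ₜ*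
      ↥(unitaryGroupOfForm (galAdicCompletionMap (L := L) (IsCMField.complexConj L) hw) ((StdForm.antidiagonal 3).over (w.1.adicCompletion L))))
    (r : SmoothIrrep ((UnitaryGroup.cmDatum L 3 H).Local v)) (hsc : r.ρ.IsSupercuspidal)
    (B : r.V →ₗ⋆[ℂ] r.V →ₗ[ℂ] ℂ) (hBinv : ∀ (g : (UnitaryGroup.cmDatum L 3 H).Local v) (x y : r.V), B (r.ρ g x) (r.ρ g y) = B x y) (v₁ : r.V) :
    ∃ (Ω' : CompactExhaustion ((UnitaryGroup.cmDatum L 3 H).Local v))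
      (F' : (UnitaryGroup.cmDatum L 3 H).Local v → ℂ) (M : (UnitaryGroup.cmDatum L 3 H).Local v → ℝ),
      (∀ᵐ g ∂μ, ¬ (IsRegularElt (g.val : GL (Fin 3) (UnitaryGroup.LocalRing L v)) ∧
          IsCompact ((Subgroup.centralizer ({g} : Set ((UnitaryGroup.cmDatum L 3 H).Local v))) : Set ((UnitaryGroup.cmDatum L 3 H).Local v))) →
        Tendsto (fun n => ∫ x in Ω' n, B v₁ (r.ρ (x * g * x⁻¹) v₁) ∂μ) atTop (𝓝 (F' g))) ∧
      (∀ n : ℕ, ∀ᵐ g ∂μ, ‖∫ x in Ω' n, B v₁ (r.ρ (x * g * x⁻¹) v₁) ∂μ‖ ≤ M g) ∧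
      LocallyIntegrable M μ := by
  letI iM : MeasurableSpace ↥(unitaryGroupOfForm (galAdicCompletionMap (L := L) (IsCMField.complexConj L) hw) ((StdForm.antidiagonal 3).over (w.1.adicCompletion L))) :=
    borel _
  haveI : BorelSpace ↥(unitaryGroupOfForm (galAdicCompletionMap (L := L) (IsCMField.complexConj L) hw) ((StdForm.antidiagonal 3).over (w.1.adicCompletion L))) := ⟨rfl⟩
  haveI : (μ.map e).IsHaarMeasure := ContinuousMulEquiv.isHaarMeasure_map μ e
  haveI : CharZero (w.1.adicCompletion L) := charZero_of_injective_algebraMap (algebraMap L (w.1.adicCompletion L)).injective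
  haveI : SecondCountableTopology ↥(unitaryGroupOfForm (galAdicCompletionMap (L := L) (IsCMField.complexConj L) hw) ((StdForm.antidiagonal 3).over (w.1.adicCompletion L))) :=
    K2E3SupercuspModelFrameAtPlace.secondCountableTopology_unitaryGroupOfForm_adicCompletion L w _ _
  haveI : LocallyCompactSpace ↥(unitaryGroupOfForm (galAdicCompletionMap (L := L) (IsCMField.complexConj L) hw) ((StdForm.antidiagonal 3).over (w.1.adicCompletion L))) :=
    K2E3SupercuspModelFrameAtPlace.locallyCompactSpace_unitaryGroupOfForm_adicCompletion L w hw _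
  have hσσ : ∀ x, galAdicCompletionMap (L := L) (IsCMField.complexConj L) hw (galAdicCompletionMap (L := L) (IsCMField.complexConj L) hw x) = x :=
    galAdicCompletionMap_galAdicCompletionMap_of_smul_eq (IsCMField.complexConj L) w (IsCMField.complexConj_ne_one L) hw
  have hσc : Continuous (galAdicCompletionMap (L := L) (IsCMField.complexConj L) hw) := continuous_galAdicCompletionMap L (IsCMField.complexConj L) hw
  have hσv : ∀ x, Valued.v (galAdicCompletionMap (L := L) (IsCMField.complexConj L) hw x) = Valued.v x :=
    fun x => valued_galAdicCompletionMap (L := L) (IsCMField.complexConj L) hw x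
  have hσ1 : ∃ x, galAdicCompletionMap (L := L) (IsCMField.complexConj L) hw x ≠ x := by
    obtain ⟨δ, hσδ, hδ⟩ := exists_skew_ne_zero_adicCompletion (IsCMField.complexConj L) (IsCMField.complexConj_ne_one L) w hw
    refine ⟨δ, fun hfix => hδ ?_⟩
    have h2 : (2 : w.1.adicCompletion L) * δ = 0 := by linear_combination hfix.symm.trans hσδ
    exact (mul_eq_zero.mp h2).resolve_left two_ne_zero
  haveI := compactSpace_integer_adicCompletion L w.1
  obtain ⟨ϖ, hϖ⟩ := exists_v_eq_exp_neg_one_adicCompletion (E := L) w.1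
  obtain ⟨ΩM, hmem, -, hinv, hmul, -⟩ := K2E3HeightBallExhaustion.exists_heightBall_compactExhaustion
    (galAdicCompletionMap (L := L) (IsCMField.complexConj L) hw) ((StdForm.antidiagonal 3).over (w.1.adicCompletion L)) hσc hϖ
  obtain ⟨Ω, R, mθ, F, Bset, -, -, hBsetc, hlim, hcanc, hθ, hdat, hregae, hballR, hballER⟩ :=
    K2E3SupercuspidalTruncatedCharLimCancExplicit.explicit_limit_localisation_and_hball_reduction L H w hw μ e ΩM hϖ hmem hinv hmul r.ρ r.isSmooth hsc B hBinv v₁ v₁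
  -- the model coefficient `θ_M`: continuous, supported in `Ω_M m_θ`, bounded by `Mb`
  have hθMc : Continuous fun m' : ↥(unitaryGroupOfForm (galAdicCompletionMap (L := L) (IsCMField.complexConj L) hw) ((StdForm.antidiagonal 3).over (w.1.adicCompletion L))) =>
      B v₁ (r.ρ (e.symm m') v₁) := (Representation.continuous_sesqForm_apply_apply (r.isSmooth v₁) v₁).comp e.symm.continuous
  have hθMcs : HasCompactSupport fun m' : ↥(unitaryGroupOfForm (galAdicCompletionMap (L := L) (IsCMField.complexConj L) hw)
      ((StdForm.antidiagonal 3).over (w.1.adicCompletion L))) => B v₁ (r.ρ (e.symm m') v₁) :=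
    HasCompactSupport.intro (ΩM.isCompact mθ) fun m' hm' => not_not.1 fun h => hm' (hθ m' h)
  obtain ⟨M₀, hM₀⟩ := hθMcs.exists_bound_of_continuous hθMc
  have hMb : ∀ m' : ↥(unitaryGroupOfForm (galAdicCompletionMap (L := L) (IsCMField.complexConj L) hw) ((StdForm.antidiagonal 3).over (w.1.adicCompletion L))),
      ‖B v₁ (r.ρ (e.symm m') v₁)‖₊ ≤ Real.toNNReal M₀ := fun m' => by
    rw [← NNReal.coe_le_coe, coe_nnnorm]
    exact (hM₀ m').trans (Real.le_coe_toNNReal M₀)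
  -- the token as an opaque function, its positivity at regular elements
  obtain ⟨T, hT⟩ : ∃ T : ↥(unitaryGroupOfForm (galAdicCompletionMap (L := L) (IsCMField.complexConj L) hw) ((StdForm.antidiagonal 3).over (w.1.adicCompletion L))) → ℝ≥0,
      ∀ m', T m' = NNReal.sqrt (NNReal.sqrt
        (normAbs (w.1.adicCompletion L) (((m' : GL (Fin 3) (w.1.adicCompletion L)) : Matrix (Fin 3) (Fin 3) (w.1.adicCompletion L))).charpoly.discr *
          (normAbs (w.1.adicCompletion L) (((m' : GL (Fin 3) (w.1.adicCompletion L)) : Matrix (Fin 3) (Fin 3) (w.1.adicCompletion L))).det ^ 2)⁻¹)) := ⟨_, fun _ => rfl⟩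
  have hT0 : ∀ m' : ↥(unitaryGroupOfForm (galAdicCompletionMap (L := L) (IsCMField.complexConj L) hw) ((StdForm.antidiagonal 3).over (w.1.adicCompletion L))),
      IsRegularElt (m' : GL (Fin 3) (w.1.adicCompletion L)) → T m' ≠ 0 := fun m' hreg => by
    have hdisc : (((m' : GL (Fin 3) (w.1.adicCompletion L)) : Matrix (Fin 3) (Fin 3) (w.1.adicCompletion L))).charpoly.discr ≠ 0 :=
      (Literature.Algebra.Polynomial.DiscriminantSignRealRoots.discr_ne_zero_iff_separable
        (by rw [Matrix.charpoly_degree_eq_dim, Fintype.card_fin]; exact_mod_cast (by norm_num : (0 : ℕ) < 3))).2 hreg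
    have hdet' : (((m' : GL (Fin 3) (w.1.adicCompletion L)) : Matrix (Fin 3) (Fin 3) (w.1.adicCompletion L))).det ≠ 0 := by
      have h := (Matrix.GeneralLinearGroup.det (m' : GL (Fin 3) (w.1.adicCompletion L))).ne_zero
      rwa [Matrix.GeneralLinearGroup.val_det_apply] at h
    rw [hT]
    intro h
    have h' := NNReal.sqrt_eq_zero.1 (NNReal.sqrt_eq_zero.1 h)
    exact mul_ne_zero ((map_ne_zero _).2 hdisc) (inv_ne_zero (pow_ne_zero 2 ((map_ne_zero _).2 hdet'))) h'
  -- the two constants: split (★ FILE A §1) and elliptic (the LETTER at `S := Ω_M m_θ`)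
  obtain ⟨C, hC⟩ := K2E3SupercuspidalTruncatedCharWeightKit.exists_const_integral_heightBall_norm_conj_le_shell_place L w hw
    (J := (StdForm.antidiagonal 3).over (w.1.adicCompletion L)) rfl (μ.map e) ΩM hϖ hmem hinv hmul mθ (E := ℂ)
  obtain ⟨Cell, hCell⟩ := hEll (galAdicCompletionMap (L := L) (IsCMField.complexConj L) hw) hσσ hσc hσv hσ1
    (J := (StdForm.antidiagonal 3).over (w.1.adicCompletion L)) rfl (μ.map e) (ΩM.isCompact mθ)
  -- `q`, `log q`, the constants `A₀`, `K₀` and the weight `W_M`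
  have hq1 : (1 : ℝ) < ((residueFieldCard (w.1.adicCompletion L) : ℝ≥0) : ℝ) := by exact_mod_cast one_lt_residueFieldCard_nnreal (F := w.1.adicCompletion L)
  have hlogq : 0 < Real.log ((residueFieldCard (w.1.adicCompletion L) : ℝ≥0) : ℝ) := Real.log_pos hq1
  set A₀ : ℝ := 24 * (mθ : ℝ) + 579 + 160 / Real.log ((residueFieldCard (w.1.adicCompletion L) : ℝ≥0) : ℝ) with hA₀
  have hA₀0 : 0 ≤ A₀ := by positivity
  set K₀ : ℝ := (C : ℝ) * (Real.toNNReal M₀ : ℝ) * A₀ + (Cell : ℝ) * (Real.toNNReal M₀ : ℝ) with hK₀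
  have hCM0 : 0 ≤ (C : ℝ) * (Real.toNNReal M₀ : ℝ) := mul_nonneg C.2 (Real.toNNReal M₀).2
  have hCellM0 : 0 ≤ (Cell : ℝ) * (Real.toNNReal M₀ : ℝ) := mul_nonneg Cell.2 (Real.toNNReal M₀).2
  have hK₀0 : 0 ≤ K₀ := add_nonneg (mul_nonneg hCM0 hA₀0) hCellM0
  have hK₀ge : (Cell : ℝ) * (Real.toNNReal M₀ : ℝ) ≤ K₀ := le_add_of_nonneg_left (mul_nonneg hCM0 hA₀0)
  have hK₀ge' : (C : ℝ) * (Real.toNNReal M₀ : ℝ) * A₀ ≤ K₀ := le_add_of_nonneg_right hCellM0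
  set W_M : ↥(unitaryGroupOfForm (galAdicCompletionMap (L := L) (IsCMField.complexConj L) hw) ((StdForm.antidiagonal 3).over (w.1.adicCompletion L))) → ℝ :=
    fun m' => K₀ * ((ΩM.find m' : ℝ) + 1) * ((residueFieldCard (w.1.adicCompletion L) : ℝ≥0) : ℝ) ^ (ΩM.find m') *
      (((T m' : ℝ))⁻¹ * (1 + |Real.log (T m' : ℝ)|) ^ 1) with hW_M
  -- `W_M ∈ L¹_loc(M, e_* μ)` (★ FILE A §4–§5), transported to `G`
  have hf := K2E3SupercuspidalTruncatedCharWeightKit.locallyIntegrable_inv_token_mul_log_pow L w hw (J := (StdForm.antidiagonal 3).over (w.1.adicCompletion L)) rfl (μ.map e) 1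
  simp only [← hT] at hf
  have hWM : LocallyIntegrable W_M (μ.map e) :=
    K2E3SupercuspidalTruncatedCharWeightKit.locallyIntegrable_heightWeight (μ.map e) ΩM hf hK₀0 hq1.le
  have hcoe : (⇑e.toHomeomorph : (UnitaryGroup.cmDatum L 3 H).Local v → _) = ⇑e := rfl
  have hW : LocallyIntegrable (fun g : (UnitaryGroup.cmDatum L 3 H).Local v => W_M (e g)) μ := by
    have h := (locallyIntegrable_map_homeomorph (μ := μ) e.toHomeomorph (f := W_M)).1 (by rw [hcoe]; exact hWM)
    rw [hcoe] at h
    exact h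
  -- the common lower bounds of `W_M`
  have hWlow : ∀ m', (1 : ℝ) * ((T m' : ℝ))⁻¹ ≤ ((ΩM.find m' : ℝ) + 1) * ((residueFieldCard (w.1.adicCompletion L) : ℝ≥0) : ℝ) ^ (ΩM.find m') *
      (((T m' : ℝ))⁻¹ * (1 + |Real.log (T m' : ℝ)|) ^ 1) := fun m' => by
    have h1 : (1 : ℝ) ≤ ((ΩM.find m' : ℝ) + 1) * ((residueFieldCard (w.1.adicCompletion L) : ℝ≥0) : ℝ) ^ (ΩM.find m') :=
      one_le_mul_of_one_le_of_one_le (by simp) (one_le_pow₀ hq1.le)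
    have h2 : ((T m' : ℝ))⁻¹ ≤ ((T m' : ℝ))⁻¹ * (1 + |Real.log (T m' : ℝ)|) ^ 1 := by
      rw [pow_one]; exact le_mul_of_one_le_right (inv_nonneg.2 (T m').2) (le_add_of_nonneg_right (abs_nonneg _))
    exact mul_le_mul h1 h2 (inv_nonneg.2 (T m').2) (zero_le_one.trans h1)
  -- THE ELLIPTIC BOUND from the letter: for `e g` regular with compact `Z_M(e g)`, the full orbital integral of `‖θ_M‖` is finite and `≤ C_ell·Mb·T(e g)⁻¹ ≤ W_M (e g)`
  have hell : ∀ g : (UnitaryGroup.cmDatum L 3 H).Local v,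
      IsRegularElt ((e g : ↥(unitaryGroupOfForm (galAdicCompletionMap (L := L) (IsCMField.complexConj L) hw) ((StdForm.antidiagonal 3).over (w.1.adicCompletion L)))) :
        GL (Fin 3) (w.1.adicCompletion L)) →
      IsCompact ((Subgroup.centralizer ({e g} : Set ↥(unitaryGroupOfForm (galAdicCompletionMap (L := L) (IsCMField.complexConj L) hw) ((StdForm.antidiagonal 3).over (w.1.adicCompletion L))))) :
        Set ↥(unitaryGroupOfForm (galAdicCompletionMap (L := L) (IsCMField.complexConj L) hw) ((StdForm.antidiagonal 3).over (w.1.adicCompletion L)))) →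
      Integrable (fun x' : ↥(unitaryGroupOfForm (galAdicCompletionMap (L := L) (IsCMField.complexConj L) hw) ((StdForm.antidiagonal 3).over (w.1.adicCompletion L))) =>
        B v₁ (r.ρ (e.symm (x' * e g * x'⁻¹)) v₁)) (μ.map e) ∧
      ∫ x', ‖B v₁ (r.ρ (e.symm (x' * e g * x'⁻¹)) v₁)‖ ∂(μ.map e) ≤ W_M (e g) := by
    intro g hreg hZM
    have hTg := hT0 (e g) hreg
    have hTg' : ((T (e g) : ℝ≥0) : ℝ≥0∞) ≠ 0 := by exact_mod_cast hTg
    -- the letter at `Θ := ‖θ_M‖ₑ`, `γ := e g`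
    have hL := hCell (fun m' => (‖B v₁ (r.ρ (e.symm m') v₁)‖₊ : ℝ≥0∞)) (measurable_coe_nnreal_ennreal.comp hθMc.nnnorm.measurable)
      (fun m' hm' => hθ m' fun h0 => hm' (by rw [h0, nnnorm_zero, ENNReal.coe_zero])) (Real.toNNReal M₀ : ℝ≥0∞) (fun m' => ENNReal.coe_le_coe.2 (hMb m')) (e g) hreg hZM
    rw [← hT] at hL
    have hI : ∫⁻ x', (‖B v₁ (r.ρ (e.symm (x' * e g * x'⁻¹)) v₁)‖₊ : ℝ≥0∞) ∂(μ.map e) ≤ (Cell : ℝ≥0∞) * (Real.toNNReal M₀ : ℝ≥0∞) / (T (e g) : ℝ≥0∞) :=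
      (ENNReal.le_div_iff_mul_le (Or.inl hTg') (Or.inl ENNReal.coe_ne_top)).2 (by rw [mul_comm]; exact hL)
    have hItop : ∫⁻ x', (‖B v₁ (r.ρ (e.symm (x' * e g * x'⁻¹)) v₁)‖₊ : ℝ≥0∞) ∂(μ.map e) < ∞ :=
      lt_of_le_of_lt hI (ENNReal.div_lt_top (ENNReal.mul_ne_top ENNReal.coe_ne_top ENNReal.coe_ne_top) hTg')
    have hcont : Continuous fun x' : ↥(unitaryGroupOfForm (galAdicCompletionMap (L := L) (IsCMField.complexConj L) hw) ((StdForm.antidiagonal 3).over (w.1.adicCompletion L))) =>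
        B v₁ (r.ρ (e.symm (x' * e g * x'⁻¹)) v₁) := hθMc.comp ((continuous_id.mul continuous_const).mul continuous_inv)
    have hint : Integrable (fun x' : ↥(unitaryGroupOfForm (galAdicCompletionMap (L := L) (IsCMField.complexConj L) hw) ((StdForm.antidiagonal 3).over (w.1.adicCompletion L))) =>
        B v₁ (r.ρ (e.symm (x' * e g * x'⁻¹)) v₁)) (μ.map e) := ⟨hcont.aestronglyMeasurable, hItop⟩
    refine ⟨hint, ?_⟩
    rw [integral_norm_eq_lintegral_enorm hcont.aestronglyMeasurable]
    have hle : (∫⁻ x', ‖B v₁ (r.ρ (e.symm (x' * e g * x'⁻¹)) v₁)‖ₑ ∂(μ.map e)).toReal ≤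
        ((Cell : ℝ≥0∞) * (Real.toNNReal M₀ : ℝ≥0∞) / (T (e g) : ℝ≥0∞)).toReal :=
      ENNReal.toReal_mono (ENNReal.div_lt_top (ENNReal.mul_ne_top ENNReal.coe_ne_top ENNReal.coe_ne_top) hTg').ne hI
    refine hle.trans ?_
    rw [ENNReal.toReal_div, ENNReal.toReal_mul, ENNReal.coe_toReal, ENNReal.coe_toReal, ENNReal.coe_toReal, div_eq_mul_inv]
    calc (Cell : ℝ) * (Real.toNNReal M₀ : ℝ) * ((T (e g) : ℝ))⁻¹ ≤ K₀ * ((1 : ℝ) * ((T (e g) : ℝ))⁻¹) := by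
          rw [one_mul]; exact mul_le_mul_of_nonneg_right hK₀ge (inv_nonneg.2 (T (e g)).2)
      _ ≤ K₀ * (((ΩM.find (e g) : ℝ) + 1) * ((residueFieldCard (w.1.adicCompletion L) : ℝ≥0) : ℝ) ^ (ΩM.find (e g)) *
            (((T (e g) : ℝ))⁻¹ * (1 + |Real.log (T (e g) : ℝ)|) ^ 1)) := mul_le_mul_of_nonneg_left (hWlow (e g)) hK₀0
      _ = W_M (e g) := by rw [hW_M]; ring
  -- THE SPLIT BOUND at the exported datum (★ FILE A §1, shell index ★ FILE A §2, depth ★ (M5e-2))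
  have hsplit : ∀ g : (UnitaryGroup.cmDatum L 3 H).Local v,
      IsRegularElt ((e g : ↥(unitaryGroupOfForm (galAdicCompletionMap (L := L) (IsCMField.complexConj L) hw) ((StdForm.antidiagonal 3).over (w.1.adicCompletion L)))) :
        GL (Fin 3) (w.1.adicCompletion L)) →
      ¬ IsCompact ((Subgroup.centralizer ({g} : Set ((UnitaryGroup.cmDatum L 3 H).Local v))) : Set ((UnitaryGroup.cmDatum L 3 H).Local v)) →
      ∫ x' in ΩM (R g), ‖B v₁ (r.ρ (e.symm (x' * e g * x'⁻¹)) v₁)‖ ∂(μ.map e) ≤ W_M (e g) := by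
    intro g hreg hZ
    obtain ⟨t, y₀, d, lam, mg, hd, -, -, hlam_min, hgm, hmg_min, -, hgy, hR⟩ := hdat g hreg hZ
    have hmg : mg = ΩM.find (e g) := le_antisymm (hmg_min _ (ΩM.mem_find _)) (ΩM.mem_iff_find_le.1 hgm)
    subst hmg
    have hTg := hT0 (e g) hreg
    obtain ⟨τ, hτ, hτle⟩ := K2E3SupercuspidalTruncatedCharWeightKit.exists_shellIndex hϖ (pos_iff_ne_zero.2 hTg)
    rw [hT] at hτ
    have htT : t ∈ torusU (galAdicCompletionMap (L := L) (IsCMField.complexConj L) hw) ((StdForm.antidiagonal 3).over (w.1.adicCompletion L)) :=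
      (mem_torusU_iff t).2 ⟨d, hd⟩
    -- depth on the shell: `λ_min ≤ 4τ + 10 h`
    have hgt : y₀ * t * y₀⁻¹ ∈ ΩM (ΩM.find (e g)) := by rw [← hgy]; exact hgm
    have hdm := fun i => (K2E3SupercuspBallBoundSplitAssembly.v_pow_mul_torus_le_one_of_conj_mem (galAdicCompletionMap (L := L) (IsCMField.complexConj L) hw) hσv rfl
      hϖ ΩM hmem hd hgt i).1
    have hdm' := fun i => (K2E3SupercuspBallBoundSplitAssembly.v_pow_mul_torus_le_one_of_conj_mem (galAdicCompletionMap (L := L) (IsCMField.complexConj L) hw) hσv rfl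
      hϖ ΩM hmem hd hgt i).2
    have hcoe' : ((e g : ↥(unitaryGroupOfForm (galAdicCompletionMap (L := L) (IsCMField.complexConj L) hw) ((StdForm.antidiagonal 3).over (w.1.adicCompletion L)))) :
        GL (Fin 3) (w.1.adicCompletion L)) =
        (y₀ : GL (Fin 3) (w.1.adicCompletion L)) * (glDiagonal 3 (w.1.adicCompletion L) d : GL (Fin 3) (w.1.adicCompletion L)) * (y₀ : GL (Fin 3) (w.1.adicCompletion L))⁻¹ := by
      rw [hgy, hd]; rfl
    have hchar : ((((e g : ↥(unitaryGroupOfForm (galAdicCompletionMap (L := L) (IsCMField.complexConj L) hw) ((StdForm.antidiagonal 3).over (w.1.adicCompletion L)))) :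
        GL (Fin 3) (w.1.adicCompletion L)) : Matrix (Fin 3) (Fin 3) (w.1.adicCompletion L))).charpoly =
        (((glDiagonal 3 (w.1.adicCompletion L) d : GL (Fin 3) (w.1.adicCompletion L)) : Matrix (Fin 3) (Fin 3) (w.1.adicCompletion L))).charpoly := by
      rw [hcoe', Units.val_mul, Units.val_mul, Matrix.coe_units_inv]
      exact Matrix.charpoly_units_conj (y₀ : GL (Fin 3) (w.1.adicCompletion L)) _
    have hdet' : ((((e g : ↥(unitaryGroupOfForm (galAdicCompletionMap (L := L) (IsCMField.complexConj L) hw) ((StdForm.antidiagonal 3).over (w.1.adicCompletion L)))) :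
        GL (Fin 3) (w.1.adicCompletion L)) : Matrix (Fin 3) (Fin 3) (w.1.adicCompletion L))).det =
        (((glDiagonal 3 (w.1.adicCompletion L) d : GL (Fin 3) (w.1.adicCompletion L)) : Matrix (Fin 3) (Fin 3) (w.1.adicCompletion L))).det := by
      rw [hcoe', Units.val_mul, Units.val_mul]
      exact Matrix.det_units_conj (y₀ : GL (Fin 3) (w.1.adicCompletion L)) _
    have hτ' := hτ
    rw [hchar, hdet'] at hτ'
    have hdepth : ∀ i k : Fin 3, i ≠ k → Valued.v (ϖ ^ (4 * τ + 10 * ΩM.find (e g))) ≤ Valued.v ((d i : w.1.adicCompletion L) - d k) := fun i k hik =>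
      K2E3SplitTorusDepthFromDiscriminant.v_pow_le_v_sub_of_pow_normAbs_le_token hϖ hdm hdm' hτ' hik
    have hlam : lam ≤ 4 * τ + 10 * ΩM.find (e g) := hlam_min _ hdepth
    have hN : (2 * (R g + 42 * ΩM.find (e g) + 2 * mθ + 16 * τ) + 1 : ℕ) ≤ 24 * mθ + 416 * ΩM.find (e g) + 160 * τ + 3 := by rw [hR]; omega
    have hN' : ((2 * (R g + 42 * ΩM.find (e g) + 2 * mθ + 16 * τ) + 1 : ℕ) : ℝ) ≤ 24 * (mθ : ℝ) + 416 * (ΩM.find (e g) : ℝ) + 160 * (τ : ℝ) + 3 := by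
      exact_mod_cast hN
    -- the shell bound (★ FILE A §1)
    have hshell := hC (fun m' => B v₁ (r.ρ (e.symm m') v₁)) hθMc hθ (Real.toNNReal M₀) hMb ⟨t, htT⟩ d hd (e g) y₀ (ΩM.find (e g)) hgm hgy τ hτ (R g)
    rw [← hT] at hshell
    refine hshell.trans ?_
    -- `(N : ℝ) ≤ A₀ · (h + 1) · (1 + |log T|)`
    set X : ℝ := |Real.log (T (e g) : ℝ)| with hX
    have hX0 : 0 ≤ X := abs_nonneg _
    have hm0 : (0 : ℝ) ≤ (ΩM.find (e g) : ℝ) := Nat.cast_nonneg _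
    have hP1 : (1 : ℝ) ≤ ((ΩM.find (e g) : ℝ) + 1) * (1 + X) := one_le_mul_of_one_le_of_one_le (by linarith) (by linarith)
    have hP0 : (0 : ℝ) ≤ ((ΩM.find (e g) : ℝ) + 1) * (1 + X) := zero_le_one.trans hP1
    have hτX : (τ : ℝ) ≤ 1 + X / Real.log ((residueFieldCard (w.1.adicCompletion L) : ℝ≥0) : ℝ) := hτle
    have hc0 : (0 : ℝ) ≤ 160 / Real.log ((residueFieldCard (w.1.adicCompletion L) : ℝ≥0) : ℝ) := by positivity
    have hNA : ((2 * (R g + 42 * ΩM.find (e g) + 2 * mθ + 16 * τ) + 1 : ℕ) : ℝ) ≤ A₀ * (((ΩM.find (e g) : ℝ) + 1) * (1 + X)) := by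
      have h1 : (24 * (mθ : ℝ) + 163) ≤ (24 * (mθ : ℝ) + 163) * (((ΩM.find (e g) : ℝ) + 1) * (1 + X)) := le_mul_of_one_le_right (by positivity) hP1
      have h2 : 416 * (ΩM.find (e g) : ℝ) ≤ 416 * (((ΩM.find (e g) : ℝ) + 1) * (1 + X)) := by nlinarith
      have h3 : 160 * (τ : ℝ) ≤ 160 + 160 / Real.log ((residueFieldCard (w.1.adicCompletion L) : ℝ≥0) : ℝ) * X := by
        have := mul_le_mul_of_nonneg_left hτX (by norm_num : (0 : ℝ) ≤ 160)
        rw [mul_add, mul_one, mul_div_assoc'] at this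
        linarith [this, show 160 * X / Real.log ((residueFieldCard (w.1.adicCompletion L) : ℝ≥0) : ℝ) =
          160 / Real.log ((residueFieldCard (w.1.adicCompletion L) : ℝ≥0) : ℝ) * X by ring]
      have h4 : 160 / Real.log ((residueFieldCard (w.1.adicCompletion L) : ℝ≥0) : ℝ) * X ≤
          160 / Real.log ((residueFieldCard (w.1.adicCompletion L) : ℝ≥0) : ℝ) * (((ΩM.find (e g) : ℝ) + 1) * (1 + X)) :=
        mul_le_mul_of_nonneg_left (by nlinarith) hc0
      rw [hA₀]
      nlinarith
    -- assemble: `C·Mb·N·q^h·T⁻¹ ≤ K₀·(h+1)·q^h·(T⁻¹(1+|log T|))`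
    have hqh : (0 : ℝ) ≤ ((residueFieldCard (w.1.adicCompletion L) : ℝ≥0) : ℝ) ^ (ΩM.find (e g)) := pow_nonneg (zero_le_one.trans hq1.le) _
    have hTinv : (0 : ℝ) ≤ ((T (e g) : ℝ))⁻¹ := inv_nonneg.2 (T (e g)).2
    calc (C : ℝ) * (Real.toNNReal M₀ : ℝ) * ((2 * (R g + 42 * ΩM.find (e g) + 2 * mθ + 16 * τ) + 1 : ℕ) : ℝ) *
          ((residueFieldCard (w.1.adicCompletion L) : ℝ≥0) : ℝ) ^ (ΩM.find (e g)) * ((T (e g) : ℝ))⁻¹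
        ≤ (C : ℝ) * (Real.toNNReal M₀ : ℝ) * (A₀ * (((ΩM.find (e g) : ℝ) + 1) * (1 + X))) *
          ((residueFieldCard (w.1.adicCompletion L) : ℝ≥0) : ℝ) ^ (ΩM.find (e g)) * ((T (e g) : ℝ))⁻¹ :=
          mul_le_mul_of_nonneg_right (mul_le_mul_of_nonneg_right (mul_le_mul_of_nonneg_left hNA hCM0) hqh) hTinv
      _ = ((C : ℝ) * (Real.toNNReal M₀ : ℝ) * A₀) * (((ΩM.find (e g) : ℝ) + 1) * ((residueFieldCard (w.1.adicCompletion L) : ℝ≥0) : ℝ) ^ (ΩM.find (e g)) *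
          (((T (e g) : ℝ))⁻¹ * (1 + X) ^ 1)) := by ring
      _ ≤ K₀ * (((ΩM.find (e g) : ℝ) + 1) * ((residueFieldCard (w.1.adicCompletion L) : ℝ≥0) : ℝ) ^ (ΩM.find (e g)) *
          (((T (e g) : ℝ))⁻¹ * (1 + X) ^ 1)) :=
          mul_le_mul_of_nonneg_right hK₀ge' (mul_nonneg (mul_nonneg (by linarith) hqh) (mul_nonneg hTinv (by rw [pow_one]; linarith)))
      _ = W_M (e g) := by rw [hW_M, hX]; ring
  -- `hball`, `hballE` through the two reductions of ★ FILE B, then ★ p856355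
  have hballE := hballER W_M (by
    filter_upwards [hregae] with g hreg hell'
    exact (hell g hreg ((K2E3TruncatedCharTransport.isCompact_centralizer_iff_of_continuousMulEquiv e g).1 hell'.2)).2)
  have hball := hballR W_M (by
    filter_upwards [hregae] with g hreg hng
    by_cases hZ : IsCompact ((Subgroup.centralizer ({g} : Set ((UnitaryGroup.cmDatum L 3 H).Local v))) : Set ((UnitaryGroup.cmDatum L 3 H).Local v))
    · obtain ⟨hint, hle⟩ := hell g hreg ((K2E3TruncatedCharTransport.isCompact_centralizer_iff_of_continuousMulEquiv e g).1 hZ)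
      exact (setIntegral_le_integral hint.norm (Eventually.of_forall fun x => norm_nonneg _)).trans hle
    · exact hsplit g hreg hZ)
  exact K2E3SupercuspidalTruncatedCharDominationOfBricks.sigSCan_datum_of_bricks L 3 H hH hdet v hns μ r hsc B hBinv v₁ Ω F hlim Bset hBsetc hcanc
    (fun g => W_M (e g)) hballE hball hW

/-! ## §3 The head: the (SC-an) datum at `N = 3` modulo «HC-14-ell» -/
set_option maxHeartbeats 800000 in -- long statement (the ∀-closed letter as a binder) on the CM ∕ one-place carriers
/-- **(M5h) HEAD — THE (SC-an) ∃-DATUM FOR A SUPERCUSPIDAL `SmoothIrrep` OF `U₃(H)(L⁺_v)` AT A NON-SPLIT PLACE, MODULO «HC-14-ell».**  For EVERY hermitian `H ∈ M₃(L)` with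
`det H ≠ 0`, `v` non-split, every Haar `μ` on `G = (cmDatum L 3 H).Local v`, every supercuspidal `SmoothIrrep r` with invariant `B`, and `v₁ : r.V`:
`∃ Ω F M, (SC-lim∖ell) ∧ (SC-dom) ∧ M ∈ L¹_loc(μ)` — EXACTLY the `hSC`-tail of ★ p856184 `charLocIntNearSemisimple_supercuspidal_of_exists_truncated` ∕ the consequent of ★ p856355
`sigSCan_datum_of_bricks` at `N = 3`, hence (with those) Harish-Chandra's Theorem 16 «the character of a supercuspidal class is a locally summable function» for `U₃(H)(L⁺_v)`,
MODULO the ONE named letter `hEll` = «HC-14-ell» (Theorem 14 for the compact Cartan subgroups of `U(σ, Φ₃)(K)`, uniform form; residual leaf of U12 :246).  Dichotomy ★ (f2)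
`isotropic_or_anisotropic`: §1 (anisotropic, letter-free) ∕ §2 (isotropic, along ★ (f2)'s field model).
[cite: HarishChandra1970, Part VII §3 Theorem 16 p. 67, pp. 70–73; Part VI §8 Theorem 14 p. 60; §2 Theorems 18–20 pp. 69–70] [cite: Rogawski1990, §12.2 p. 173, §12.5 p. 182, §14.2 p. 232] -/
theorem sigSCan_datum_of_hc14Ell
    (hEll : ∀ {K : Type} [Field K] [Valued K ℤᵐ⁰] [ValuativeRel K] [(Valued.v : Valuation K ℤᵐ⁰).Compatible] [IsNonarchimedeanLocalField K]
      [CharZero K] (σ : K →+* K) (_ : ∀ x, σ (σ x) = x) (_ : Continuous σ) (_ : ∀ x, Valued.v (σ x) = Valued.v x) (_ : ∃ x : K, σ x ≠ x)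
      {J : Matrix (Fin 3) (Fin 3) K} (_ : J = (StdForm.antidiagonal 3).over K)
      [MeasurableSpace ↥(unitaryGroupOfForm σ J)] [BorelSpace ↥(unitaryGroupOfForm σ J)] (μ : Measure ↥(unitaryGroupOfForm σ J)) [μ.IsHaarMeasure]
      {S : Set ↥(unitaryGroupOfForm σ J)} (_ : IsCompact S),
      ∃ C : ℝ≥0, ∀ Θ : ↥(unitaryGroupOfForm σ J) → ℝ≥0∞, Measurable Θ → (∀ g, Θ g ≠ 0 → g ∈ S) → ∀ M : ℝ≥0∞, (∀ g, Θ g ≤ M) →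
        ∀ γ : ↥(unitaryGroupOfForm σ J), IsRegularElt (γ : GL (Fin 3) K) →
          IsCompact ((Subgroup.centralizer ({γ} : Set ↥(unitaryGroupOfForm σ J))) : Set ↥(unitaryGroupOfForm σ J)) →
            ((NNReal.sqrt (NNReal.sqrt
                (normAbs K (((γ : GL (Fin 3) K) : Matrix (Fin 3) (Fin 3) K)).charpoly.discr *
                  (normAbs K (((γ : GL (Fin 3) K) : Matrix (Fin 3) (Fin 3) K)).det ^ 2)⁻¹)) : ℝ≥0) : ℝ≥0∞) *
              ∫⁻ x, Θ (x * γ * x⁻¹) ∂μ ≤ C * M)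
    (hH : (H.map (cmConjRingHom L))ᵀ = H) (hdet : H.det ≠ 0)
    (v : HeightOneSpectrum (𝓞 ↥(maximalRealSubfield L))) (hns : ∀ w : PlacesOver L v, IsCMField.complexConj L • w.1 = w.1)
    [MeasurableSpace ((UnitaryGroup.cmDatum L 3 H).Local v)] [BorelSpace ((UnitaryGroup.cmDatum L 3 H).Local v)]
    (μ : Measure ((UnitaryGroup.cmDatum L 3 H).Local v)) [μ.IsHaarMeasure]
    (r : SmoothIrrep ((UnitaryGroup.cmDatum L 3 H).Local v)) (hsc : r.ρ.IsSupercuspidal)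
    (B : r.V →ₗ⋆[ℂ] r.V →ₗ[ℂ] ℂ) (hBinv : ∀ (g : (UnitaryGroup.cmDatum L 3 H).Local v) (x y : r.V), B (r.ρ g x) (r.ρ g y) = B x y) (v₁ : r.V) :
    ∃ (Ω' : CompactExhaustion ((UnitaryGroup.cmDatum L 3 H).Local v))
      (F' : (UnitaryGroup.cmDatum L 3 H).Local v → ℂ) (M : (UnitaryGroup.cmDatum L 3 H).Local v → ℝ),
      (∀ᵐ g ∂μ, ¬ (IsRegularElt (g.val : GL (Fin 3) (UnitaryGroup.LocalRing L v)) ∧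
          IsCompact ((Subgroup.centralizer ({g} : Set ((UnitaryGroup.cmDatum L 3 H).Local v))) : Set ((UnitaryGroup.cmDatum L 3 H).Local v))) →
        Tendsto (fun n => ∫ x in Ω' n, B v₁ (r.ρ (x * g * x⁻¹) v₁) ∂μ) atTop (𝓝 (F' g))) ∧
      (∀ n : ℕ, ∀ᵐ g ∂μ, ‖∫ x in Ω' n, B v₁ (r.ρ (x * g * x⁻¹) v₁) ∂μ‖ ≤ M g) ∧
      LocallyIntegrable M μ := by
  obtain ⟨w⟩ := (inferInstance : Nonempty (PlacesOver L v))
  have hw : IsCMField.complexConj L • w.1 = w.1 := hns w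
  rcases K2E3RankOneIsotropicPhi3Model.isotropic_or_anisotropic (σ := galAdicCompletionMap (L := L) (IsCMField.complexConj L) hw) (placeForm H w.1) with hiso | hanis
  · obtain ⟨e⟩ := K2E3RankOneIsotropicPhi3Model.nonempty_continuousMulEquiv_cmLocal_fieldModel_of_isotropic L H hH (isUnit_iff_ne_zero.2 hdet) w hw hiso
    exact sigSCan_datum_of_hc14Ell_of_fieldModel L H hEll hH hdet v hns w hw μ e r hsc B hBinv v₁
  · haveI : CompactSpace ((UnitaryGroup.cmDatum L 3 H).Local v) :=
      compactSpace_local_of_anisotropic (IsCMField.complexConj L) H v w hw (IsCMField.complexConj_ne_one L) hanis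
    exact sigSCan_datum_of_compactSpace L H hH hdet v hns μ r hsc B hBinv v₁

end Summit.HodgeConjecture.HodgeConjecture.Cruxes.H413.K2E3SupercuspidalTruncatedCharAnalyticOfHC14Ell

end
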